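import Summits.AtomisticToContinuum.BoseEinsteinCondensation.Theses.BECConjugateDomination
import HarnessLib

/-!
# A Dirichlet-native sufficient condition for the conjunct (and the crux), with no boundary transfer:
# condensed near-minimisers of ONE good minorant per volume
# (crux `BECConjugateDomination.HardCoreExtension`, stmt-AtomisticToContinuum-11786 — line `near-minimiser-slack-transfer`, lead c7)

The "single good level" form of the line's residue (`nearMinimiserTowerBEC_iff_singleGoodLevel`, `…NearMinTowerNecessityCore.lean`)
read in the crux's OWN setting (Dirichlet boxes, `condensateNumber`): slack matching needs no energy-convergence theorem and no
boundary transfer once the energy deficit is part of the hypothesis. At fixed `(N, L)`, if `w ≤ v` pointwise,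
`E₀^D(v) + δ' ≤ E₀^D(w) + δ` and every `δ`-near-minimiser of `w` has `λ_max(γ_Ψ) ≥ m`, then every `δ'`-near-minimiser of `v` is a
`δ`-near-minimiser of `w`, so `condensateNumber v N L ≥ m` (`le_condensateNumber_of_goodMinorant`). Hence
(`boseEinsteinCondensation_of_goodMinorants`, `hardCoreExtension_of_goodMinorants`): if every admissible `v` admits, at every small
density and eventually in `N`, ONE minorant `w ≤ v` (e.g. a smooth-class soft sphere below a hard core) whose Dirichlet
near-minimisers condense with a slack beating the deficit `E₀^D(v; N, L_N) − E₀^D(w; N, L_N)`, the conjunct — and the crux — follow,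
in the Dirichlet setting of the crux's own antecedent `A`. What `A` lacks is exactly the comparison "slack > deficit": it provides,
for each smooth `w`, SOME slack `δ(w, N) > 0` (`hasGroundStateBEC_iff_nearMin`, `…NearMinNormalForm.lean`) and nothing about its size.

References: E. H. Lieb, R. Seiringer, J. P. Solovej, J. Yngvason, *The Mathematics of the Bose Gas and its Condensation* (2005),
§1.2 (1.17)–(1.19), Ch. 5 p. 42.
-/

noncomputable section

namespace Summit.AtomisticToContinuum.BoseEinsteinCondensation.Cruxes.HardCoreExtension.NearMinTower

open MeasureTheory Filter
open scoped ENNReal NNReal Topology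
open Literature.MathematicalPhysics.QuantumManyBody.BoseGas
open Summit.AtomisticToContinuum.BoseEinsteinCondensation.Theses.BECConjugateDomination

/-- Dirichlet energies are monotone in the potential. [cite: LSSY2005, §1.2 (1.16)] -/
theorem energy_mono_of_le {v w : ℝ → ℝ≥0∞} (h : ∀ r, w r ≤ v r) {N : ℕ} {L : ℝ} (Ψ : TrialState N L) :
    energy w Ψ ≤ energy v Ψ :=
  lintegral_mono fun _ => add_le_add le_rfl
    (mul_le_mul' (Finset.sum_le_sum fun _ _ => Finset.sum_le_sum fun _ _ => h _) le_rfl)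

/-- … and so are the Dirichlet ground-state energies. [cite: LSSY2005, (2.3)] -/
theorem groundStateEnergy_mono_of_le {v w : ℝ → ℝ≥0∞} (h : ∀ r, w r ≤ v r) (N : ℕ) (L : ℝ) :
    groundStateEnergy w N L ≤ groundStateEnergy v N L :=
  iInf_mono fun Ψ => energy_mono_of_le h Ψ

/-- **Slack matching at fixed volume, Dirichlet form.** If `w ≤ v` pointwise, `E₀^D(v) + δ' ≤ E₀^D(w) + δ` with `δ' > 0`, and every
`δ`-near-minimiser of `w` has `λ_max(γ_Ψ) ≥ m`, then `condensateNumber v N L ≥ m`: every `δ'`-near-minimiser of `v` is a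
`δ`-near-minimiser of `w` (`E_w Ψ ≤ E_v Ψ ≤ E₀^D(v) + δ' ≤ E₀^D(w) + δ`). No spectral data, no convergence, no transfer.
[cite: LSSY2005, §1.2 (1.17)–(1.19)] -/
theorem le_condensateNumber_of_goodMinorant {v w : ℝ → ℝ≥0∞} (hwv : ∀ r, w r ≤ v r) {N : ℕ} {L : ℝ} {δ δ' m : ℝ≥0∞}
    (hδ' : 0 < δ') (hdef : groundStateEnergy v N L + δ' ≤ groundStateEnergy w N L + δ)
    (hBEC : ∀ Ψ : TrialState N L, energy w Ψ ≤ groundStateEnergy w N L + δ → m ≤ maxOccupation N Ψ.ψ) :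
    m ≤ condensateNumber v N L :=
  le_condensateNumber v hδ' fun Ψ hΨ => hBEC Ψ
    (calc energy w Ψ ≤ energy v Ψ := energy_mono_of_le hwv Ψ
      _ ≤ groundStateEnergy v N L + δ' := hΨ
      _ ≤ groundStateEnergy w N L + δ := hdef)

/-- **The conjunct from ONE good minorant per volume** (Dirichlet-native, no boundary transfer): if every repulsive finite-range `v`
admits, at all small densities and eventually in `N`, a minorant `w ≤ v` whose Dirichlet `δ`-near-minimisers in the box of side
`(N/ρ)^{1/3}` have `λ_max ≥ cN`, with a slack `δ` beating the energy deficit (`E₀^D(v) + δ' ≤ E₀^D(w) + δ`, `δ' > 0`), then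
`BoseEinsteinCondensation`. [cite: LSSY2005, §1.2 (1.19) and Ch. 5 p. 42] -/
theorem boseEinsteinCondensation_of_goodMinorants
    (h : ∀ v : ℝ → ℝ≥0∞, IsRepulsiveFiniteRange v →
      ∃ ρ₀ : ℝ, 0 < ρ₀ ∧ ∀ ρ : ℝ, 0 < ρ → ρ < ρ₀ → ∃ c : ℝ, 0 < c ∧ ∀ᶠ N : ℕ in atTop,
        ∃ w : ℝ → ℝ≥0∞, (∀ r, w r ≤ v r) ∧ ∃ δ δ' : ℝ≥0∞, 0 < δ' ∧
          groundStateEnergy v N (sideLength ρ N) + δ' ≤ groundStateEnergy w N (sideLength ρ N) + δ ∧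
          ∀ Ψ : TrialState N (sideLength ρ N), energy w Ψ ≤ groundStateEnergy w N (sideLength ρ N) + δ →
            ENNReal.ofReal (c * N) ≤ maxOccupation N Ψ.ψ) :
    Literature.MathematicalPhysics.QuantumManyBody.BoseGas.BoseEinsteinCondensation := by
  intro v hv
  obtain ⟨ρ₀, hρ₀, hth⟩ := h v hv
  refine ⟨ρ₀, hρ₀, fun ρ hρ hρlt => ?_⟩
  obtain ⟨c, hc, hN⟩ := hth ρ hρ hρlt
  refine ⟨c, hc, ?_⟩
  filter_upwards [hN] with N hN₁
  obtain ⟨w, hwv, δ, δ', hδ', hdef, hBEC⟩ := hN₁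
  exact le_condensateNumber_of_goodMinorant hwv hδ' hdef hBEC

/-- **The crux from ONE good minorant per volume** (its own antecedent again unused; compare `hasGroundStateBEC_iff_nearMin`: the
antecedent supplies, for each smooth `w`, some slack `δ(w, N) > 0` and no comparison with the deficit). [cite: LSSY2005, Ch. 5 p. 42] -/
theorem hardCoreExtension_of_goodMinorants :
    (∀ v : ℝ → ℝ≥0∞, IsRepulsiveFiniteRange v →
      ∃ ρ₀ : ℝ, 0 < ρ₀ ∧ ∀ ρ : ℝ, 0 < ρ → ρ < ρ₀ → ∃ c : ℝ, 0 < c ∧ ∀ᶠ N : ℕ in atTop,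
        ∃ w : ℝ → ℝ≥0∞, (∀ r, w r ≤ v r) ∧ ∃ δ δ' : ℝ≥0∞, 0 < δ' ∧
          groundStateEnergy v N (sideLength ρ N) + δ' ≤ groundStateEnergy w N (sideLength ρ N) + δ ∧
          ∀ Ψ : TrialState N (sideLength ρ N), energy w Ψ ≤ groundStateEnergy w N (sideLength ρ N) + δ →
            ENNReal.ofReal (c * N) ≤ maxOccupation N Ψ.ψ) →
    HardCoreExtension :=
  fun h _ => boseEinsteinCondensation_of_goodMinorants h

end Summit.AtomisticToContinuum.BoseEinsteinCondensation.Cruxes.HardCoreExtension.NearMinTower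

end
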